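import Summits.Ventures.PercRepro.C041TriangleMarkedStar3
import Summits.Ventures.PercRepro.C041TriangleTransferLeafK3

/-!
# THE FIRST LEVEL OF THE CONE — a star with `P₁ + B + AB ≥ 2` and `P₂ + A + AB ≥ 2` is a mixture of marked
leaves, hence `H` holds on every pair of such stars (mine-3, gen 68; C-041.md §21 (bh))

The cone `InCone` is generated by the pure stars `V b = ∏ v (b i)`, `(L₀, L₁, L₂, M₀, M₁, M₂) = (1, P₁, P₂, AB, A, B)`
with `P₁ = ∏ (1 + bᵢ²)`, `P₂ = ∏ (1 + (1 − bᵢ)²)`, `A = ∏ bᵢ`, `B = ∏ (1 − bᵢ)`.  Its FIRST LEVEL is the sub-cone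
`K₁ᵐ` generated by the marked leaves `v s · X(p,q)` and the marked vertices `X(p,q) = v 1 ^ p * v 0 ^ q`.  On every
single leaf the two linear forms `Λ₁ = L₁ + M₂ + M₀ − 2L₀` and `Λ₂ = L₂ + M₁ + M₀ − 2L₀` vanish
(`1 + s² + (1 − s) + s(1 − s) = 2`): a single leaf has no room.  A star with `Λ₁ ≥ 0` and `Λ₂ ≥ 0` (and `A + B < 1`)
does: `firstLevel_decomp` writes `D • V b`, `D = (1 − A + B)(1 + A − B)(2ⁿ − 2)`, as an explicit NON-NEGATIVE
combination of SIX generators — the leaf `v s` at `s = (1 + A − B)/2` (carrying all of `M₀ = AB`, weight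
`4AB(2ⁿ − 2)`), the marks `v 1`, `v 0` (the remaining `A`, `B`), and `X(1,1)`, `X(n,1)`, `X(1,n)` (the remaining mass
`1 − A − B`, the excess `Λ₁` placed on `X(n,1)` and `Λ₂` on `X(1,n)`, `2ⁿ ≥ 2 + (Λ₁ + Λ₂)/(1 − A − B)`).
Since `θ_△(X(p,q), w′) ∈ cone` for every cone element `w′` (`InCone_thetaTri_marks_any'`), bilinearity gives
THE FIRST-LEVEL TRANSFER `InCone_thetaTri_firstLevel_of`: `θ_△(V a, w′) ∈ cone` as soon as the single leaf `v s`
of the decomposition is settled against `w′`.  Hence **THEOREM (H ON THE FIRST LEVEL)**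
`InCone_thetaTri_firstLevel_firstLevel`: `θ_△(V a, V b) ∈ cone` for ALL pairs of stars with `Λ₁, Λ₂ ≥ 0` and
`A + B < 1` each — an infinite family of pure pairs of every size `(m, m′)` (e.g. `(½, ½, ½)` against `(½, ½, ½)`,
every `(½)^m` against every `(½)^{m′}`, `m, m′ ≥ 3`) — and `InCone_thetaTri_firstLevel_star3Marks`: a first-level
star against every star with ≤ 3 interior leaves and arbitrary marks.  (The criterion is SUFFICIENT for
`K₁ᵐ`-membership; the B-carriers `v s · v 0 ^ q` reach a little further — C-041.md §21 (bh).)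
-/

namespace PercRepro

namespace RelaxedTriangle

open TreeClosure

/-- The six-vector of a pure star in terms of its invariants `(P₁, P₂, A, B)`. -/
theorem V_eq_vec {m : ℕ} (b : Fin m → ℝ) :
    V b = ![1, V b 1, V b 2, V b 4 * V b 5, V b 4, V b 5] := by
  have h0 : V b 0 = 1 := by simp [V_apply, v]
  have h3 : V b 3 = V b 4 * V b 5 := by simp [V_apply, v, Finset.prod_mul_distrib]
  ext i
  fin_cases i <;> simp [h0, h3]

/-- **THE FIRST-LEVEL DECOMPOSITION** (scaled by `D = (1 − A + B)(1 + A − B)(2^(n+1) − 2)`): the six-vector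
`(1, P₁, P₂, AB, A, B)` times `D` is the combination of the leaf `v ((1 + A − B)/2)`, the marks `v 1`, `v 0` and the
marked vertices `X(1,1)`, `X(n+1,1)`, `X(1,n+1)` with the displayed coefficients (an exact polynomial identity). -/
theorem firstLevel_decomp (A B P₁ P₂ : ℝ) (n : ℕ) :
    ((1 - A + B) * (1 + A - B) * ((2 : ℝ) ^ (n + 1) - 2)) • (![1, P₁, P₂, A * B, A, B] : Vec6) =
      (4 * A * B * ((2 : ℝ) ^ (n + 1) - 2)) • v ((1 + A - B) / 2)
      + (A * (1 - A - B) * (1 + A - B) * ((2 : ℝ) ^ (n + 1) - 2)) • v 1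
      + (B * (1 - A - B) * (1 - A + B) * ((2 : ℝ) ^ (n + 1) - 2)) • v 0
      + ((1 - A + B) * (1 + A - B) * ((1 - A - B) * ((2 : ℝ) ^ (n + 1) - 2)
          - (P₁ + B + A * B - 2) - (P₂ + A + A * B - 2))) • (v 1 * v 0)
      + ((1 - A + B) * (1 + A - B) * (P₁ + B + A * B - 2)) • (v 1 ^ (n + 1) * v 0)
      + ((1 - A + B) * (1 + A - B) * (P₂ + A + A * B - 2)) • (v 1 * v 0 ^ (n + 1)) := by
  rw [pow_v_one_eq (n + 1) (by omega), pow_v_zero_eq (n + 1) (by omega)]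
  ext i
  simp only [Pi.smul_apply, Pi.add_apply, Pi.mul_apply, smul_eq_mul, v]
  fin_cases i <;> simp <;> ring

/-- **THE FIRST-LEVEL TRANSFER**: if `(1, P₁, P₂, AB, A, B)` satisfies `A, B ≥ 0`, `A + B < 1`, `P₁ + B + AB ≥ 2`
and `P₂ + A + AB ≥ 2`, then `θ_△((1, P₁, P₂, AB, A, B), w′) ∈ cone` for every cone element `w′` against which the
leaf `v ((1 + A − B)/2)` is settled. -/
theorem InCone_thetaTri_firstLevel_of (A B P₁ P₂ : ℝ) (hA : 0 ≤ A) (hB : 0 ≤ B) (hAB : A + B < 1)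
    (h1 : 2 ≤ P₁ + B + A * B) (h2 : 2 ≤ P₂ + A + A * B) {w' : Vec6} (hw' : InCone w')
    (hs : InCone (thetaTri (v ((1 + A - B) / 2)) w')) :
    InCone (thetaTri (![1, P₁, P₂, A * B, A, B] : Vec6) w') := by
  have hν : 0 < 1 - A - B := by linarith
  obtain ⟨n, hn⟩ := pow_unbounded_of_one_lt
    (((P₁ + B + A * B - 2) + (P₂ + A + A * B - 2)) / (1 - A - B) + 2) (one_lt_two : (1 : ℝ) < 2)
  have hq : 0 ≤ ((P₁ + B + A * B - 2) + (P₂ + A + A * B - 2)) / (1 - A - B) :=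
    div_nonneg (by linarith) hν.le
  have h2n : (2 : ℝ) ^ n ≤ (2 : ℝ) ^ (n + 1) := by
    rw [pow_succ]; nlinarith [pow_pos (by norm_num : (0 : ℝ) < 2) n]
  have hN4 : 0 < (2 : ℝ) ^ (n + 1) - 2 := by linarith
  have hN2 : (P₁ + B + A * B - 2) + (P₂ + A + A * B - 2) ≤ (1 - A - B) * ((2 : ℝ) ^ (n + 1) - 2) := by
    have hle : ((P₁ + B + A * B - 2) + (P₂ + A + A * B - 2)) / (1 - A - B) ≤ (2 : ℝ) ^ (n + 1) - 2 := by
      linarith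
    have := (div_le_iff₀ hν).1 hle
    linarith
  have hE : 0 < (1 - A + B) * (1 + A - B) := mul_pos (by linarith) (by linarith)
  have hD : 0 < (1 - A + B) * (1 + A - B) * ((2 : ℝ) ^ (n + 1) - 2) := mul_pos hE hN4
  -- the scaled triangle value is a non-negative combination of settled values
  have key : ((1 - A + B) * (1 + A - B) * ((2 : ℝ) ^ (n + 1) - 2)) •
      thetaTri (![1, P₁, P₂, A * B, A, B] : Vec6) w' =
      (4 * A * B * ((2 : ℝ) ^ (n + 1) - 2)) • thetaTri (v ((1 + A - B) / 2)) w'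
      + (A * (1 - A - B) * (1 + A - B) * ((2 : ℝ) ^ (n + 1) - 2)) • thetaTri (v 1) w'
      + (B * (1 - A - B) * (1 - A + B) * ((2 : ℝ) ^ (n + 1) - 2)) • thetaTri (v 0) w'
      + ((1 - A + B) * (1 + A - B) * ((1 - A - B) * ((2 : ℝ) ^ (n + 1) - 2)
          - (P₁ + B + A * B - 2) - (P₂ + A + A * B - 2))) • thetaTri (v 1 * v 0) w'
      + ((1 - A + B) * (1 + A - B) * (P₁ + B + A * B - 2)) • thetaTri (v 1 ^ (n + 1) * v 0) w'
      + ((1 - A + B) * (1 + A - B) * (P₂ + A + A * B - 2)) • thetaTri (v 1 * v 0 ^ (n + 1)) w' := by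
    rw [← thetaTri_smul_left, firstLevel_decomp A B P₁ P₂ n]
    simp only [thetaTri_add_left, thetaTri_smul_left]
  have hn1 : InCone (thetaTri (v 1 ^ (n + 1) * v 0) w') := by
    have := InCone_thetaTri_marks_any' (n + 1) 1 hw'
    rwa [pow_one] at this
  have h1n : InCone (thetaTri (v 1 * v 0 ^ (n + 1)) w') := by
    have := InCone_thetaTri_marks_any' 1 (n + 1) hw'
    rwa [pow_one] at this
  have hsum : InCone (((1 - A + B) * (1 + A - B) * ((2 : ℝ) ^ (n + 1) - 2)) •
      thetaTri (![1, P₁, P₂, A * B, A, B] : Vec6) w') := by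
    rw [key]
    refine ((((InCone.smul _ ?_ hs).add (InCone.smul _ ?_ (InCone_thetaTri_v1_any hw'))).add
      (InCone.smul _ ?_ (InCone_thetaTri_v0_any hw'))).add
      (InCone.smul _ ?_ (InCone_thetaTri_X11 hw'))).add (InCone.smul _ ?_ hn1) |>.add (InCone.smul _ ?_ h1n)
    · exact mul_nonneg (mul_nonneg (mul_nonneg (by norm_num) hA) hB) hN4.le
    · exact mul_nonneg (mul_nonneg (mul_nonneg hA hν.le) (by linarith)) hN4.le
    · exact mul_nonneg (mul_nonneg (mul_nonneg hB hν.le) (by linarith)) hN4.le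
    · exact mul_nonneg hE.le (by linarith)
    · exact mul_nonneg hE.le (by linarith)
    · exact mul_nonneg hE.le (by linarith)
  have := InCone.smul ((1 - A + B) * (1 + A - B) * ((2 : ℝ) ^ (n + 1) - 2))⁻¹ (inv_nonneg.2 hD.le) hsum
  rwa [smul_smul, inv_mul_cancel₀ hD.ne', one_smul] at this

/-- The invariants of a star: `0 ≤ A`, `0 ≤ B` and `M₀ = A·B`. -/
theorem V_invariants {m : ℕ} (b : Fin m → ℝ) (hb : ∀ i, 0 ≤ b i ∧ b i ≤ 1) :
    0 ≤ V b 4 ∧ 0 ≤ V b 5 ∧ V b 3 = V b 4 * V b 5 := by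
  have h4 : V b 4 = ∏ i, b i := by simp [V_apply, v]
  have h5 : V b 5 = ∏ i, (1 - b i) := by simp [V_apply, v]
  have h3 : V b 3 = (∏ i, b i) * ∏ i, (1 - b i) := by simp [V_apply, v, Finset.prod_mul_distrib]
  refine ⟨?_, ?_, ?_⟩
  · rw [h4]; exact Finset.prod_nonneg fun i _ => (hb i).1
  · rw [h5]; exact Finset.prod_nonneg fun i _ => by linarith [(hb i).2]
  · rw [h3, h4, h5]

/-- **THE FIRST-LEVEL TRANSFER FOR STARS**: a star `a` with `A + B < 1`, `P₁ + B + AB ≥ 2`, `P₂ + A + AB ≥ 2` is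
settled against every cone element `w′` against which the leaf `v ((1 + A − B)/2)` is settled. -/
theorem InCone_thetaTri_firstLevel_star_of {m : ℕ} (a : Fin m → ℝ) (ha : ∀ i, 0 ≤ a i ∧ a i ≤ 1)
    (hAB : V a 4 + V a 5 < 1) (h1 : 2 ≤ V a 1 + V a 5 + V a 3) (h2 : 2 ≤ V a 2 + V a 4 + V a 3)
    {w' : Vec6} (hw' : InCone w') (hs : InCone (thetaTri (v ((1 + V a 4 - V a 5) / 2)) w')) :
    InCone (thetaTri (V a) w') := by
  obtain ⟨hA, hB, h3⟩ := V_invariants a ha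
  rw [h3] at h1 h2
  rw [V_eq_vec a]
  exact InCone_thetaTri_firstLevel_of _ _ _ _ hA hB hAB h1 h2 hw' hs

/-- The leaf of the first-level decomposition lies in `[0, 1]`. -/
theorem firstLevel_leaf_mem {m : ℕ} (a : Fin m → ℝ) (ha : ∀ i, 0 ≤ a i ∧ a i ≤ 1) (hAB : V a 4 + V a 5 < 1) :
    0 ≤ (1 + V a 4 - V a 5) / 2 ∧ (1 + V a 4 - V a 5) / 2 ≤ 1 := by
  obtain ⟨hA, hB, -⟩ := V_invariants a ha
  constructor <;> linarith

/-- **THEOREM (H ON THE FIRST LEVEL)**: `θ_△(V a, V b) ∈ cone` for every two stars with `A + B < 1`,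
`P₁ + B + AB ≥ 2` and `P₂ + A + AB ≥ 2` each — whatever their numbers of leaves. -/
theorem InCone_thetaTri_firstLevel_firstLevel {m m' : ℕ} (a : Fin m → ℝ) (b : Fin m' → ℝ)
    (ha : ∀ i, 0 ≤ a i ∧ a i ≤ 1) (hb : ∀ i, 0 ≤ b i ∧ b i ≤ 1)
    (hAB : V a 4 + V a 5 < 1) (h1 : 2 ≤ V a 1 + V a 5 + V a 3) (h2 : 2 ≤ V a 2 + V a 4 + V a 3)
    (hAB' : V b 4 + V b 5 < 1) (h1' : 2 ≤ V b 1 + V b 5 + V b 3) (h2' : 2 ≤ V b 2 + V b 4 + V b 3) :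
    InCone (thetaTri (V a) (V b)) := by
  refine InCone_thetaTri_firstLevel_star_of a ha hAB h1 h2 (InCone_V b hb) ?_
  rw [thetaTri_comm]
  refine InCone_thetaTri_firstLevel_star_of b hb hAB' h1' h2' (InCone_v _ (firstLevel_leaf_mem a ha hAB)) ?_
  exact thetaTri_v_InCone _ _ (firstLevel_leaf_mem b hb hAB') (firstLevel_leaf_mem a ha hAB)

/-- **THEOREM (A FIRST-LEVEL STAR AGAINST EVERY STAR WITH ≤ 3 INTERIOR LEAVES AND ANY MARKS)**. -/
theorem InCone_thetaTri_firstLevel_star3Marks {m : ℕ} (a : Fin m → ℝ) (ha : ∀ i, 0 ≤ a i ∧ a i ≤ 1)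
    (hAB : V a 4 + V a 5 < 1) (h1 : 2 ≤ V a 1 + V a 5 + V a 3) (h2 : 2 ≤ V a 2 + V a 4 + V a 3)
    (b c d : ℝ) (hb : 0 ≤ b ∧ b ≤ 1) (hc : 0 ≤ c ∧ c ≤ 1) (hd : 0 ≤ d ∧ d ≤ 1) (p q : ℕ) :
    InCone (thetaTri (V a) (v b * v c * v d * (v 1 ^ p * v 0 ^ q))) :=
  InCone_thetaTri_firstLevel_star_of a ha hAB h1 h2
    ((((InCone_v b hb).mul (InCone_v c hc)).mul (InCone_v d hd)).mul
      ((InCone_pow_v_one p).mul (InCone_pow_v_zero q)))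
    (InCone_thetaTri_leaf_star3_marks b c d _ hb hc hd (firstLevel_leaf_mem a ha hAB) p q)

/-- **A FIRST-LEVEL STAR AGAINST EVERY ELEMENT OF `K₃⁺`** (the explicit cone of `1`, the leaves, the two- and
three-leaf products and the marked vertices). -/
theorem InCone_thetaTri_firstLevel_K3plus {m : ℕ} (a : Fin m → ℝ) (ha : ∀ i, 0 ≤ a i ∧ a i ≤ 1)
    (hAB : V a 4 + V a 5 < 1) (h1 : 2 ≤ V a 1 + V a 5 + V a 3) (h2 : 2 ≤ V a 2 + V a 4 + V a 3)
    {n₁ n₂ n₃ n₄ : ℕ} (l0 : ℝ) (hl0 : 0 ≤ l0)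
    (μ s : Fin n₁ → ℝ) (hμ : ∀ i, 0 ≤ μ i) (hs : ∀ i, 0 ≤ s i ∧ s i ≤ 1)
    (ρ s' t' : Fin n₂ → ℝ) (hρ : ∀ j, 0 ≤ ρ j) (hs' : ∀ j, 0 ≤ s' j ∧ s' j ≤ 1) (ht' : ∀ j, 0 ≤ t' j ∧ t' j ≤ 1)
    (κ s'' t'' u'' : Fin n₃ → ℝ) (hκ : ∀ k, 0 ≤ κ k) (hs'' : ∀ k, 0 ≤ s'' k ∧ s'' k ≤ 1)
    (ht'' : ∀ k, 0 ≤ t'' k ∧ t'' k ≤ 1) (hu'' : ∀ k, 0 ≤ u'' k ∧ u'' k ≤ 1)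
    (ν : Fin n₄ → ℝ) (p q : Fin n₄ → ℕ) (hν : ∀ l, 0 ≤ ν l) :
    InCone (thetaTri (V a) (l0 • (1 : Vec6) + ∑ i, μ i • v (s i) + ∑ j, ρ j • (v (s' j) * v (t' j))
      + ∑ k, κ k • (v (s'' k) * v (t'' k) * v (u'' k)) + ∑ l, ν l • (v 1 ^ p l * v 0 ^ q l))) := by
  refine InCone_thetaTri_firstLevel_star_of a ha hAB h1 h2 ?_
    (InCone_thetaTri_leaf_K3plus _ (firstLevel_leaf_mem a ha hAB) l0 hl0 μ s hμ hs ρ s' t' hρ hs' ht'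
      κ s'' t'' u'' hκ hs'' ht'' hu'' ν p q hν)
  refine ((((InCone.smul _ hl0 InCone_one).add (InCone_sum fun i => (InCone_v _ (hs i)).smul _ (hμ i))).add
    (InCone_sum fun j => ((InCone_v _ (hs' j)).mul (InCone_v _ (ht' j))).smul _ (hρ j))).add
    (InCone_sum fun k => (((InCone_v _ (hs'' k)).mul (InCone_v _ (ht'' k))).mul (InCone_v _ (hu'' k))).smul _
      (hκ k))).add (InCone_sum fun l => ((InCone_pow_v_one (p l)).mul (InCone_pow_v_zero (q l))).smul _ (hν l))

end RelaxedTriangle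

end PercRepro
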